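import Summits.QuantumFields.YangMills.Theorems.LuscherReductionOneSiteLevelsValleyAlgebra
import Summits.QuantumFields.YangMills.Theorems.LuscherReductionOneSiteLevelsKacChart
import Summits.QuantumFields.YangMills.Theorems.LuscherReductionRunningReductionConstLift
import Summits.QuantumFields.YangMills.Theorems.LuscherReductionDressedRitzPolyakovLiftTransplantDilation
import HarnessLib

/-!
# The CONSTANT-MODE TUBE, part 1: balanced gnomonic coordinates transverse to the constant configurations, the tube map, and its INJECTIVITY
# (lane A of S-BASE, crux `TwistedTraceScaling` stmt-QuantumFields-20203, sub-target C4 INNER; design note `pub/ym-fleet/ym-luscher-20007-p1/COARSE-DESIGN.md` §23)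

THE MAP.  `tubeMap L u y : GaugeConfig 3 L SU2`, `(tubeMap L u y)_e = P(1, y_e) · u_{dir e}` — a per-link gnomonic step `P(1, y_e) = gnoPoint y_e` (upper
hemisphere) on top of the constant lift `constLift L u` of a ONE-SITE configuration `u` (`tubeMap_eq_mul_constLift`; the step sits on the LEFT, the
convention of `…InnerSlowManifold` / `…InnerKineticSplit`) — with the transverse coordinate `y : Edge → ℝ³` BALANCED: `Σ_x y_{(x,k)} = 0` for every direction
`k` and colour (`balancedSet`; a closed linear subspace of codimension `9`, the complement of the constant modes in the gnomonic linear structure).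
* `tubeMap_mul`: `tubeMap L (u·v) y = tubeMap L u y · constLift L v` — the one-site group law is RIGHT multiplication by constant configurations.
* ★★ `tubeMap_injective`: on `(one-site configs) × (balanced y)` the map is INJECTIVE — globally, no smallness: if `P(1,y_e) u_k = P(1,y'_e) u'_k` on every
  link of direction `k` then `d = u'_k u_k⁻¹` satisfies, with the positive numbers `q_x = d₀ − y'_{(x,k)}·d⃗` (`link_relation`), `Σ_x 1/q_x = Σ_x q_x = L³ d₀`,
  which with `q + 1/q ≥ 2` and `d₀² + |d⃗|² = 1` forces `d₀ = 1`, `d = 1` (`eq_one_of_balance`; quaternion algebra of `…ValleyAlgebra`, no chart formula).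
The sequel `…ConstTubeMeasure` turns this into the EXACT product disintegration `σ^{⊗E} = σ^{⊗3} ⊗ π` on the tube (uniqueness of Haar measure): the slow
variable of the Born–Oppenheimer chart of the inner region carries the ONE-SITE a-priori measure with no Jacobian.
HONEST FRAMING: elementary algebra for a stub of a child of the CONDITIONAL reduction route R2b1; no kernel estimate; C4 OPEN; not infinite volume, not a
gap, not Clay.
-/

set_option autoImplicit false

noncomputable section

open MeasureTheory Filter Topology Real
open scoped BigOperators Matrix
open Literature.MathematicalPhysics.QuantumFieldTheory
open Literature.MathematicalPhysics.QuantumLattice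
open Literature.MathematicalPhysics.QuantumFieldTheory.Balaban1983to89.T4CubeChartGnomonic (gnoPoint continuous_gnoPoint gnoPoint_zero)

namespace Summit.QuantumFields.YangMills.Theorems.FemtoTransferGap.TwoLattice.ConstTube

open Summit.QuantumFields.YangMills.Theorems.FemtoTransferGap

variable (L : ℕ) [NeZero L]

/-! ## §1 Balanced transverse coordinates -/

/-- **Balanced coordinates**: the set of `y : Edge → ℝ³` with zero sum over the sites in every direction and colour, `Σ_x y_{(x,k)} a = 0` — the
linear complement of the `9` constant modes in the gnomonic linear structure. [folklore] -/
def balancedSet : Set (Edge 3 L → Fin 3 → ℝ) := {y | ∀ (k : Fin 3) (a : Fin 3), ∑ x : Site 3 L, y (x, k) a = 0}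

/-- Membership in the balanced set. [folklore] -/
theorem mem_balancedSet (y : Edge 3 L → Fin 3 → ℝ) : y ∈ balancedSet L ↔ ∀ (k : Fin 3) (a : Fin 3), ∑ x : Site 3 L, y (x, k) a = 0 := Iff.rfl

/-- The balanced set is closed (finitely many closed linear conditions). [folklore] -/
theorem isClosed_balancedSet : IsClosed (balancedSet L) := by
  have h : balancedSet L = ⋂ k : Fin 3, ⋂ a : Fin 3, {y : Edge 3 L → Fin 3 → ℝ | ∑ x : Site 3 L, y (x, k) a = 0} := by
    ext y; simp [balancedSet]
  rw [h]
  refine isClosed_iInter fun k => isClosed_iInter fun a => ?_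
  exact isClosed_eq (continuous_finsetSum _ fun x _ => (continuous_apply a).comp (continuous_apply (x, k))) continuous_const

/-- The balanced set is measurable. [folklore] -/
theorem measurableSet_balancedSet : MeasurableSet (balancedSet L) := (isClosed_balancedSet L).measurableSet

/-- `0` is balanced. [folklore] -/
theorem zero_mem_balancedSet : (0 : Edge 3 L → Fin 3 → ℝ) ∈ balancedSet L := fun _ _ => by simp

/-! ## §2 The tube map -/

/-- **The tube map**: a balanced-or-not gnomonic step on top of a constant configuration, `(tubeMap L u y)_e = P(1, y_e) · u_{(0, dir e)}`
(`= gnoPoint (y e) * constLift L u e`). [cite: Luscher1983, §3] -/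
def tubeMap (u : GaugeConfig 3 1 SU2) (y : Edge 3 L → Fin 3 → ℝ) : GaugeConfig 3 L SU2 :=
  fun e => gnoPoint (y e) * u (0, e.2)

omit [NeZero L] in
/-- Links of the tube map. [folklore] -/
@[simp] theorem tubeMap_apply (u : GaugeConfig 3 1 SU2) (y : Edge 3 L → Fin 3 → ℝ) (e : Edge 3 L) :
    tubeMap L u y e = gnoPoint (y e) * u (0, e.2) := rfl

omit [NeZero L] in
/-- The tube map is the gnomonic step times the constant lift. [folklore] -/
theorem tubeMap_eq_mul_constLift (u : GaugeConfig 3 1 SU2) (y : Edge 3 L → Fin 3 → ℝ) :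
    tubeMap L u y = (fun e => gnoPoint (y e)) * constLift L u := by
  funext e; simp [tubeMap, constLift]

omit [NeZero L] in
/-- At `y = 0` the tube map is the constant lift. [folklore] -/
theorem tubeMap_zero (u : GaugeConfig 3 1 SU2) : tubeMap L u 0 = constLift L u := by
  funext e; simp [tubeMap, constLift, gnoPoint_zero]

omit [NeZero L] in
/-- ★ The tube map intertwines the one-site group law with RIGHT multiplication by constant configurations:
`tubeMap L (u·v) y = tubeMap L u y · constLift L v`. [folklore] -/
theorem tubeMap_mul (u v : GaugeConfig 3 1 SU2) (y : Edge 3 L → Fin 3 → ℝ) :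
    tubeMap L (u * v) y = tubeMap L u y * constLift L v := by
  funext e; simp [tubeMap, constLift, mul_assoc]

omit [NeZero L] in
/-- The constant lift is multiplicative. [folklore] -/
theorem constLift_mul (u v : GaugeConfig 3 1 SU2) : constLift L (u * v) = constLift L u * constLift L v := by
  funext e; simp [constLift]

omit [NeZero L] in
/-- The constant lift of `1` is `1`. [folklore] -/
theorem constLift_one' : constLift L (1 : GaugeConfig 3 1 SU2) = 1 := by
  funext e; simp [constLift]

omit [NeZero L] in
/-- The tube map is jointly continuous. [folklore] -/
theorem continuous_tubeMap : Continuous fun p : GaugeConfig 3 1 SU2 × (Edge 3 L → Fin 3 → ℝ) => tubeMap L p.1 p.2 := by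
  refine continuous_pi fun e => ?_
  simp only [tubeMap]
  exact ((continuous_gnoPoint.comp ((continuous_apply e).comp continuous_snd)).mul ((continuous_apply _).comp continuous_fst))

omit [NeZero L] in
/-- The tube map is jointly measurable. [folklore] -/
theorem measurable_tubeMap : Measurable fun p : GaugeConfig 3 1 SU2 × (Edge 3 L → Fin 3 → ℝ) => tubeMap L p.1 p.2 := by
  haveI : SecondCountableTopology SU2 := secondCountableTopology_su2
  refine measurable_pi_lambda _ fun e => ?_
  simp only [tubeMap]
  exact (continuous_gnoPoint.measurable.comp ((measurable_pi_apply e).comp measurable_snd)).mul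
    ((measurable_pi_apply _).comp measurable_fst)

omit [NeZero L] in
/-- For fixed `y`, `u ↦ tubeMap L u y` is measurable. [folklore] -/
theorem measurable_tubeMap_left (y : Edge 3 L → Fin 3 → ℝ) : Measurable fun u : GaugeConfig 3 1 SU2 => tubeMap L u y := by
  refine measurable_pi_lambda _ fun e => ?_
  simp only [tubeMap]
  exact measurable_const.mul (measurable_pi_apply _)

/-! ## §3 Injectivity on balanced coordinates -/

/-- An element of `SU(2)` with scalar part `1` is `1`. [folklore] -/
theorem eq_one_of_scalarPart_eq_one {d : SU2} (h : scalarPart d = 1) : d = 1 := by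
  have hsq := scalarPart_sq_add d
  rw [h, one_pow] at hsq
  have hv0 : ∑ a, vecPart d a ^ 2 = 0 := by linarith
  have hv : ∀ a, vecPart d a = 0 := fun a => by
    have := (Finset.sum_eq_zero_iff_of_nonneg fun b _ => sq_nonneg (vecPart d b)).mp hv0 a (Finset.mem_univ a)
    exact pow_eq_zero_iff (n := 2) (by norm_num) |>.mp this
  refine eq_of_scalarPart_eq_of_vecPart_eq (by rw [h, PolyakovLift.scalarPart_one]) ?_
  rw [PolyakovLift.vecPart_one]; funext a; exact hv a

/-- The vector part of a gnomonic point is its scalar part times the coordinate: `P(1,y)⃗ = P(1,y)₀ • y`. [folklore] -/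
theorem vecPart_gnoPoint_eq_smul (y : Fin 3 → ℝ) : vecPart (gnoPoint y) = scalarPart (gnoPoint y) • y := by
  funext a; rw [Pi.smul_apply, smul_eq_mul, vecPart_gnoPoint, scalarPart_gnoPoint]

/-- ★ **One link**: if `P(1,y) = P(1,y')·d` then, with `q = d₀ − y'·d⃗ > 0`, `q · (y·d⃗) = |d⃗|² + d₀ (y'·d⃗)`. [folklore] -/
theorem link_relation {y y' : Fin 3 → ℝ} {d : SU2} (h : gnoPoint y = gnoPoint y' * d) :
    0 < scalarPart d - y' ⬝ᵥ vecPart d ∧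
      (scalarPart d - y' ⬝ᵥ vecPart d) * (y ⬝ᵥ vecPart d) = vecPart d ⬝ᵥ vecPart d + scalarPart d * (y' ⬝ᵥ vecPart d) := by
  set ρ := scalarPart (gnoPoint y) with hρ
  set ρ' := scalarPart (gnoPoint y') with hρ'
  have hρ0 : 0 < ρ := scalarPart_gnoPoint_pos y
  have hρ'0 : 0 < ρ' := scalarPart_gnoPoint_pos y'
  -- scalar parts
  have hs : ρ = ρ' * (scalarPart d - y' ⬝ᵥ vecPart d) := by
    have h1 := congrArg scalarPart h
    rw [scalarPart_mul, vecPart_gnoPoint_eq_smul, smul_dotProduct] at h1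
    rw [hρ, h1, ← hρ']; simp only [smul_eq_mul]; ring
  have hq : 0 < scalarPart d - y' ⬝ᵥ vecPart d := by
    by_contra hle
    push Not at hle
    have : ρ ≤ 0 := by rw [hs]; exact mul_nonpos_of_nonneg_of_nonpos hρ'0.le hle
    linarith
  refine ⟨hq, ?_⟩
  -- vector parts, dotted with `d⃗`
  have h2 : vecPart (gnoPoint y) ⬝ᵥ vecPart d = vecPart (gnoPoint y' * d) ⬝ᵥ vecPart d := by rw [h]
  rw [vecPart_mul, vecPart_gnoPoint_eq_smul, vecPart_gnoPoint_eq_smul, add_dotProduct, add_dotProduct, smul_dotProduct, smul_dotProduct,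
    smul_dotProduct, ← hρ, ← hρ'] at h2
  have hcross : (ρ' • y') ⨯₃ vecPart d ⬝ᵥ vecPart d = 0 := by rw [dotProduct_comm]; exact dot_cross_self _ _
  rw [hcross, add_zero] at h2
  simp only [smul_eq_mul, smul_dotProduct] at h2
  -- `h2 : ρ * (y ⬝ᵥ d⃗) = ρ' * (d⃗ ⬝ᵥ d⃗) + scalarPart d * (ρ' * (y' ⬝ᵥ d⃗))`
  rw [hs] at h2
  have h3 : ρ' * ((scalarPart d - y' ⬝ᵥ vecPart d) * (y ⬝ᵥ vecPart d)) = ρ' * (vecPart d ⬝ᵥ vecPart d + scalarPart d * (y' ⬝ᵥ vecPart d)) := by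
    linear_combination h2
  exact mul_left_cancel₀ hρ'0.ne' h3

/-- ★ **The summed inequality**: positive numbers `q_x` with `q_x · w_x = m + s·(s − q_x)`, `Σ w_x = 0`, `Σ (s − q_x) = 0` over a nonempty finite index
set and `s² + m = 1`, `m ≥ 0` force `s = 1` (AM–GM `q + 1/q ≥ 2`). [folklore] -/
theorem eq_one_of_balance {ι : Type*} [Fintype ι] [Nonempty ι] {q w : ι → ℝ} {s m : ℝ} (hq : ∀ x, 0 < q x)
    (hrel : ∀ x, q x * w x = m + s * (s - q x)) (hw : ∑ x, w x = 0) (ht : ∑ x, (s - q x) = 0) (hsm : s ^ 2 + m = 1) (hm : 0 ≤ m) : s = 1 := by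
  -- `w_x = 1/q_x − s`
  have hw' : ∀ x, w x = (q x)⁻¹ - s := fun x => by
    have h := hrel x
    have hqx := hq x
    field_simp
    nlinarith [h, hsm]
  have hsum1 : ∑ x, (q x)⁻¹ = Fintype.card ι * s := by
    have h := hw
    simp_rw [hw'] at h
    rw [Finset.sum_sub_distrib, Finset.sum_const, Finset.card_univ, nsmul_eq_mul] at h
    linarith
  have hsum2 : ∑ x, q x = Fintype.card ι * s := by
    rw [Finset.sum_sub_distrib, Finset.sum_const, Finset.card_univ, nsmul_eq_mul] at ht
    linarith
  have hamgm : ∀ x, 2 ≤ q x + (q x)⁻¹ := fun x => by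
    have hqx := hq x
    rw [← sub_nonneg]
    have : q x + (q x)⁻¹ - 2 = (q x - 1) ^ 2 / q x := by field_simp; ring
    rw [this]; positivity
  have hN : (0 : ℝ) < Fintype.card ι := by exact_mod_cast Fintype.card_pos
  have hsum : 2 * (Fintype.card ι : ℝ) ≤ 2 * (Fintype.card ι * s) := by
    calc 2 * (Fintype.card ι : ℝ) = ∑ _x : ι, (2 : ℝ) := by rw [Finset.sum_const, Finset.card_univ, nsmul_eq_mul, mul_comm]
      _ ≤ ∑ x, (q x + (q x)⁻¹) := Finset.sum_le_sum fun x _ => hamgm x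
      _ = 2 * (Fintype.card ι * s) := by rw [Finset.sum_add_distrib, hsum1, hsum2]; ring
  have hs1 : 1 ≤ s := by nlinarith
  nlinarith

omit [NeZero L] in
/-- On one site every link is the direction link `(0, k)`. [folklore] -/
theorem oneSite_ext {u u' : GaugeConfig 3 1 SU2} (h : ∀ k : Fin 3, u (0, k) = u' (0, k)) : u = u' := by
  funext e
  rw [show e = (0, e.2) from Prod.ext (Subsingleton.elim _ _) rfl]
  exact h e.2

/-- ★★ **INJECTIVITY of the tube map on balanced coordinates** (global, no smallness): `tubeMap L u y = tubeMap L u' y'` with `y, y'` balanced forces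
`u = u'` and `y = y'`. [folklore] -/
theorem tubeMap_injective {u u' : GaugeConfig 3 1 SU2} {y y' : Edge 3 L → Fin 3 → ℝ} (hy : y ∈ balancedSet L) (hy' : y' ∈ balancedSet L)
    (h : tubeMap L u y = tubeMap L u' y') : u = u' ∧ y = y' := by
  -- per direction `k`: the relative constant `d = u'_k u_k⁻¹`
  have hd : ∀ k : Fin 3, u' (0, k) * (u (0, k))⁻¹ = 1 := by
    intro k
    set d := u' (0, k) * (u (0, k))⁻¹ with hd_def
    have hlink : ∀ x : Site 3 L, gnoPoint (y (x, k)) = gnoPoint (y' (x, k)) * d := fun x => by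
      have he := congrFun h (x, k)
      simp only [tubeMap_apply] at he
      rw [hd_def, ← mul_assoc, ← he, mul_assoc, mul_inv_cancel, mul_one]
    -- the link relations
    have hrel := fun x => link_relation (hlink x)
    set s := scalarPart d
    set v := vecPart d
    have hsm : s ^ 2 + v ⬝ᵥ v = 1 := by
      have h1 := scalarPart_sq_add d
      simp only [dotProduct, ← sq]
      exact h1
    have hm : 0 ≤ v ⬝ᵥ v := by
      simp only [dotProduct, ← sq]; exact Finset.sum_nonneg fun a _ => sq_nonneg _
    -- sums over sites vanish by balance
    have hw : ∑ x : Site 3 L, y (x, k) ⬝ᵥ v = 0 := by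
      simp only [dotProduct]
      rw [Finset.sum_comm]
      refine Finset.sum_eq_zero fun a _ => ?_
      rw [← Finset.sum_mul, hy k a, zero_mul]
    have ht : ∑ x : Site 3 L, (s - (s - y' (x, k) ⬝ᵥ v)) = 0 := by
      simp only [sub_sub_cancel, dotProduct]
      rw [Finset.sum_comm]
      refine Finset.sum_eq_zero fun a _ => ?_
      rw [← Finset.sum_mul, hy' k a, zero_mul]
    have hs1 : s = 1 :=
      eq_one_of_balance (q := fun x : Site 3 L => s - y' (x, k) ⬝ᵥ v) (w := fun x => y (x, k) ⬝ᵥ v) (fun x => (hrel x).1)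
        (fun x => by have := (hrel x).2; simp only [sub_sub_cancel]; linarith) hw ht hsm hm
    exact eq_one_of_scalarPart_eq_one hs1
  have hu : u = u' := by
    refine oneSite_ext fun k => ?_
    have := hd k
    rw [mul_inv_eq_one] at this
    exact this.symm
  refine ⟨hu, ?_⟩
  funext e
  have he := congrFun h e
  rw [tubeMap_apply, tubeMap_apply, hu] at he
  have hg : gnoPoint (y e) = gnoPoint (y' e) := mul_right_cancel he
  have := congrArg gnLink hg
  rwa [gnLink_gnoPoint, gnLink_gnoPoint] at this

end Summit.QuantumFields.YangMills.Theorems.FemtoTransferGap.TwoLattice.ConstTube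

end
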